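import Summits.HubbardSuperconductivity.HubbardLadder.ClusterCutFrames
import Summits.HubbardSuperconductivity.HubbardLadder.PieceDecomposition
import HarnessLib

/-!
# Cluster pair-cuts, kernel certificates §1–§2: bit semantics of `actBits`, codes of configurations, half filling

HONEST FRAMING: ladder R1–R4 with certified numbers; no claim on H/H₀.  Cell pub-hubbard, lane r2-eng-1 (g13); design memo
`pub-hubbard-r2-eng-1/psdcert-g12/C-SPEC-g12.md` §7 + `pub-hubbard-r2-eng-1/it4cert-g13/README.md`.  Infrastructure for the cluster
pair-cut road ([C](c) → (d) seam); it certifies no cell by itself.  All statements [folklore].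

§1 `testBit_actBits` (the bit semantics of the kernel's bitmask map `actBits`: image table + optional global flip) and
`actBits_encodeBits`: with the image table `permTable π` of a site permutation `π`, `actBits` sends the code of a configuration `σ` to
the code of `σ ∘ π⁻¹` (then flipped) — the kernel-side twin of `permOp_mulVec_single` / `flipOp_mulVec_single` (Oct12Representation §5).
§2 `weightBits_encodeBits` (bit weight = number of `↓` sites), the half-filling code list `halfConfs N`, and
`mem_halfConfs_of_weightZero`: a vector annihilated by `S^z_tot` (spin ½, `totalSpin_two_mulVec_apply`) is supported on half-filling
codes — so a kernel SPAN check over `halfConfs N` covers the whole weight-zero sector.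
-/

namespace Summit.HubbardSuperconductivity.HubbardLadder.ClusterCut

open Matrix Literature.MathematicalPhysics.QuantumLattice

/-! ## §1 Bit semantics of `actBits` and its action on encoded configurations -/

section ActBits

variable {N : ℕ}

/-- Bits of the `foldl`-accumulated image: bit `j` is set iff it was set in the accumulator or some listed set bit `i` of `b`
is sent to `j` by the table. [folklore] -/
theorem testBit_foldl_perm (perm : List ℕ) (b j : ℕ) :
    ∀ (l : List ℕ) (acc : ℕ),
      (l.foldl (fun acc i => if b.testBit i then acc ||| 2 ^ (perm.getD i i) else acc) acc).testBit j =
        (acc.testBit j || l.any fun i => b.testBit i && decide (perm.getD i i = j)) := by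
  intro l
  induction l with
  | nil => intro acc; simp
  | cons i l ih =>
    intro acc
    rw [List.foldl_cons, ih, List.any_cons]
    by_cases hb : b.testBit i = true
    · rw [if_pos hb, hb, Nat.testBit_or, Nat.testBit_two_pow, Bool.true_and, Bool.or_assoc]
    · rw [if_neg hb]
      simp [hb]

/-- **Bit semantics of `actBits`**: bit `j` of `actBits N perm flip b` = (`flip` and `j < N`) xor (some set bit `i < N` of `b` has
table image `j`). [folklore] -/
theorem testBit_actBits (N : ℕ) (perm : List ℕ) (flip : Bool) (b j : ℕ) :
    (actBits N perm flip b).testBit j =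
      ((flip && decide (j < N)) ^^ ((List.range N).any fun i => b.testBit i && decide (perm.getD i i = j))) := by
  unfold actBits
  cases flip
  · simp only [Bool.false_eq_true, if_false, Bool.false_and, Bool.false_xor]
    rw [testBit_foldl_perm, Nat.zero_testBit, Bool.false_or]
  · simp only [if_true, Bool.true_and]
    rw [Nat.testBit_xor, Nat.testBit_two_pow_sub_one, testBit_foldl_perm, Nat.zero_testBit, Bool.false_or]

/-- The image table `[π 0, π 1, …, π (N-1)]` of a permutation of `Fin N` (the kernel-side form of a site permutation). [folklore] -/
def permTable (π : Equiv.Perm (Fin N)) : List ℕ := List.ofFn fun i : Fin N => (π i : ℕ)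

/-- Table lookup = the permutation. [folklore] -/
theorem permTable_getD (π : Equiv.Perm (Fin N)) (i : Fin N) : (permTable π).getD (i : ℕ) (i : ℕ) = π i := by
  unfold permTable
  rw [List.getD_eq_getElem?_getD, List.getElem?_ofFn]
  simp [i.isLt]

/-- Bits of an encoded configuration below `N`: bit `j` is set iff site `j` is `↓`. [folklore] -/
theorem testBit_encodeBits_of_lt (σ : Fin N → Fin 2) {j : ℕ} (h : j < N) :
    (encodeBits σ).testBit j = decide (σ ⟨j, h⟩ = 1) := by
  have e := congrFun (decodeBits_encodeBits σ) ⟨j, h⟩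
  rw [decodeBits_apply] at e
  cases ht : (encodeBits σ).testBit j
  · simp only [ht, Bool.false_eq_true, if_false] at e
    rw [← e]; decide
  · simp only [ht, if_true] at e
    rw [← e]; decide

/-- Bits of an encoded configuration at or above `N` vanish. [folklore] -/
theorem testBit_encodeBits_of_ge (σ : Fin N → Fin 2) {j : ℕ} (h : N ≤ j) : (encodeBits σ).testBit j = false :=
  Nat.testBit_lt_two_pow (lt_of_lt_of_le (encodeBits_lt σ) (Nat.pow_le_pow_right (by norm_num) h))

/-- In `Fin 2`, `rev x = 1 ↔ x ≠ 1`. [folklore] -/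
theorem fin2_rev_eq_one_iff (x : Fin 2) : Fin.rev x = 1 ↔ ¬ x = 1 := by
  fin_cases x <;> decide

/-- **`actBits` realises the basis action**: with the image table of a site permutation `π`, `actBits` sends the code of `σ` to the
code of `σ ∘ π⁻¹` (bit `i` moves to bit `π i`), followed by the global flip when `flip = true`. [folklore] -/
theorem actBits_encodeBits (π : Equiv.Perm (Fin N)) (flip : Bool) (σ : Fin N → Fin 2) :
    actBits N (permTable π) flip (encodeBits σ) =
      encodeBits (fun x => if flip then Fin.rev (σ (π.symm x)) else σ (π.symm x)) := by
  apply Nat.eq_of_testBit_eq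
  intro j
  rw [testBit_actBits]
  by_cases hj : j < N
  · rw [testBit_encodeBits_of_lt _ hj]
    have hany : ((List.range N).any fun i => (encodeBits σ).testBit i && decide ((permTable π).getD i i = j))
        = decide (σ (π.symm ⟨j, hj⟩) = 1) := by
      apply Bool.eq_iff_iff.mpr
      rw [List.any_eq_true, decide_eq_true_iff]
      constructor
      · rintro ⟨i, hi, h⟩
        rw [List.mem_range] at hi
        rw [Bool.and_eq_true, decide_eq_true_eq, testBit_encodeBits_of_lt σ hi, decide_eq_true_eq] at h
        have hg := permTable_getD π ⟨i, hi⟩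
        simp only at hg
        rw [hg] at h
        have hx : π.symm ⟨j, hj⟩ = ⟨i, hi⟩ := by
          rw [Equiv.symm_apply_eq]; exact Fin.ext h.2.symm
        rw [hx]; exact h.1
      · intro h
        refine ⟨(π.symm ⟨j, hj⟩ : ℕ), List.mem_range.mpr (π.symm ⟨j, hj⟩).isLt, ?_⟩
        rw [Bool.and_eq_true, decide_eq_true_eq, testBit_encodeBits_of_lt σ (π.symm ⟨j, hj⟩).isLt, decide_eq_true_eq,
          permTable_getD]
        exact ⟨h, by simp⟩
    rw [hany]
    cases flip
    · simp
    · simp only [Bool.true_and, hj, decide_true, Bool.true_xor, if_true]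
      rw [Bool.eq_iff_iff]
      simp [fin2_rev_eq_one_iff]
  · have hj' : N ≤ j := not_lt.mp hj
    rw [testBit_encodeBits_of_ge _ hj']
    have hany : ((List.range N).any fun i => (encodeBits σ).testBit i && decide ((permTable π).getD i i = j)) = false := by
      rw [Bool.eq_false_iff]
      intro h
      rw [List.any_eq_true] at h
      obtain ⟨i, hi, h⟩ := h
      rw [List.mem_range] at hi
      rw [Bool.and_eq_true, decide_eq_true_eq] at h
      have hg := permTable_getD π ⟨i, hi⟩
      simp only at hg
      rw [hg] at h
      have := (π ⟨i, hi⟩).isLt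
      omega
    rw [hany]
    simp [hj]

end ActBits

/-! ## §2 Half filling: the weight of an encoded configuration and the support of the `S^z_tot = 0` sector -/

section Weight

variable {N : ℕ}

/-- The bit weight of an encoded configuration is its number of `↓` sites. [folklore] -/
theorem weightBits_encodeBits (σ : Fin N → Fin 2) : weightBits N (encodeBits σ) = ∑ i : Fin N, (σ i : ℕ) := by
  unfold weightBits
  have hl : (do let a ← List.finRange N; pure (a : ℕ)) = (List.finRange N).map (fun a : Fin N => (a : ℕ)) := by
    simp [List.map_eq_flatMap]
  rw [hl, List.filter_map, List.length_map]
  have hf : (List.finRange N).filter ((fun i : ℕ => (encodeBits σ).testBit i) ∘ fun a : Fin N => (a : ℕ)) =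
      (List.finRange N).filter fun i => decide (σ i = 1) :=
    List.filter_congr fun i _ => by simp only [Function.comp_apply]; rw [testBit_encodeBits_of_lt σ i.isLt]
  rw [hf, ← List.toFinset_card_of_nodup ((List.nodup_finRange N).filter _), List.toFinset_filter,
    List.toFinset_finRange, Finset.card_filter]
  refine Finset.sum_congr rfl fun i _ => ?_
  have : σ i = 0 ∨ σ i = 1 := by
    rcases σ i with ⟨v, hv⟩
    interval_cases v <;> simp
  rcases this with h | h <;> simp [h]

/-- The bitmasks below `2^N` of weight exactly `N/2` (for even `N`: the `S^z_tot = 0` sector; empty for odd `N`). [folklore] -/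
def halfConfs (N : ℕ) : List ℕ := (List.range (2 ^ N)).filter fun b => 2 * weightBits N b = N

/-- **Support of the weight-zero sector**: if `S^z_tot v = 0` and `v σ ≠ 0` then the code of `σ` is a half-filling bitmask. [folklore] -/
theorem mem_halfConfs_of_weightZero {v : TensorIndex (Fin N) 2 → ℂ} (hv : (totalSpin 1 2 : Op (Fin N) 2) *ᵥ v = 0)
    {σ : Fin N → Fin 2} (hσ : v σ ≠ 0) : encodeBits σ ∈ halfConfs N := by
  have h := congrFun hv σ
  rw [totalSpin_two_mulVec_apply, Pi.zero_apply, mul_eq_zero] at h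
  have hm : mag 1 σ = 0 := by
    rcases h with h | h
    · exact_mod_cast h
    · exact absurd h hσ
  rw [mag_eq, Fintype.card_fin] at hm
  unfold halfConfs
  rw [List.mem_filter, List.mem_range, decide_eq_true_eq, weightBits_encodeBits]
  refine ⟨encodeBits_lt σ, ?_⟩
  have h2 : ((2 * ∑ i : Fin N, (σ i : ℕ) : ℕ) : ℝ) = (N : ℝ) := by
    push_cast at hm ⊢
    linarith
  exact_mod_cast h2

end Weight


end Summit.HubbardSuperconductivity.HubbardLadder.ClusterCut
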